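import Summits.QuantumFields.YangMills.Theorems.UnitScaleTiltProp7CovariantCurlOfGrad
import HarnessLib

/-!
# Route `UnitScaleTilt`, crux K1 «MinimiserStabilityRegPr» (stmt-QuantumFields-19200), route-R E′ path (α′), S3 (P-cov3 CURVED) letters —
# THE CO-CURL OF THE CURVATURE COMMUTATOR: `D*_ν(D_UD_Uφ)(p_{νμ})` is a CONJUGATION DIFFERENCE of `φ(x)` by the plaquette at `x` and the
# transported plaquette at `x − e_ν` (the covariant derivative of the curvature, [Balaban1985RegularSpaces] (1.1)–(1.2)) PLUS terms carrying one
# covariant difference `D_Uφ` and one plaquette defect `U(∂p) − 1`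

Cell `ym3-torus`, width seat `ym-ust-19200-w4` (gen 6); ★★OWNER g28 ACK 76 (2)(i) «w4: T1 + T2 GO-BY-DEFAULT» (2026-08-28 19:24Z) on this seat's
`LOCATE-PCOV3-CURVED-w4g6.md` (19200 evidence #51, §4 «Weitzenböck pairing»).  THEOREMS ONLY (0 `def`, 0 `sorry`); `--supports stmt-QuantumFields-19200`,
count-neutral.  YM₃ on T³ is a ladder rung (R3), not the Clay problem; nothing here claims S3, E′, the stub, the crux, d = 4 or the mass gap.

WHY.  In the curved transcription of the flat ζ-row engine (✓`Prop7CentreHarmonicDivEngine`) the covariant Hodge potential `φ₀` of `Y = B + D_Wφ₀` enters the curl through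
`curl_W D_Wφ₀ = R(W(∂p))g − g` (✓`Prop7CovariantCurlOfGrad.curl_covD_eq_conj_plaqU`), a curvature commutator of SIZE `2a‖φ₀‖` (✓`norm_curl_covD_le`) — the ABSOLUTE value of
`φ₀` (the located obstacle «J-gauge»).  The cross term `⟨curl_W B, curl_W D_Wφ₀⟩ = ⟨B, D*D_U(D_Uφ₀)⟩` ((3.9), ✓`B9Eq39Adjoint.sum_curl_mul`) is governed by the CO-CURL
`D*D_U(D_Uφ)_μ(x) = Σ_ν D*_ν(D_UD_Uφ)(p_{νμ})(x)` (✓`B9Eq39Adjoint.divP_curl`), computed here EXACTLY at the base point `x` (any ring, any background of units, commuting shifts):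
  `D*_ν(D_UD_Uφ)(p_{νμ})(x) = [R(P̆_ν)φ(x) − R(P_ν)φ(x)] + ℛ_ν(x)`,  `P_ν = U(∂p_{νμ}(x))`,  `P̆_ν = U_ν(x−e_ν)⁻¹·U(∂p_{νμ}(x−e_ν))·U_ν(x−e_ν)`,
where EVERY term of `ℛ_ν(x)` carries a covariant difference of `φ` AND a factor `R(plaquette)(·) − (·)` — so at a background with `‖U(∂p) − 1‖ ≤ a` and bond variables of
norm `≤ 1` with inverses of norm `≤ 1`, `‖ℛ_ν(x)‖ ≤ 2a·(‖D_νφ(x−e_ν)‖ + 3‖D_νφ(x+e_μ)‖ + 3‖D_μφ(x)‖ + ‖D_νφ(x−e_ν+e_μ)‖ + ‖D_μφ(x−e_ν)‖)`, and the ONLY term with `φ`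
undifferentiated is the conjugation difference by the plaquette at `x` and the TRANSPORTED NEIGHBOURING plaquette — the covariant derivative of the curvature
([Balaban1985RegularSpaces] (1.1)–(1.2); on (6)(e) its oriented `ν`-sum is the divergence clause (1.9), `DivSmall`): `‖Σ_ν[R(P̆_ν)X − R(P_ν)X]‖ ≤ 2·‖Σ_ν(P̆_ν − P_ν)‖·‖X‖ + 8|ι|a²·‖X‖`.
CONSEQUENCE (LOCATE §4): at covariantly divergence-free curvature the cross term is `O(a)‖B‖‖D_Wφ₀‖ + O(a²)‖B‖‖φ₀‖`; on (6)(e) the first-order coefficient of `‖φ₀‖` is the (1.9)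
quantity `eℓ⁻³`; at the R2-critical background it is the constraint force.  Nothing here decides S3 — these are the exact letters any curved engine must use.

WHAT IS PROVED (ns `…Theorems.Prop7CoCurlOfCurvatureCommutator`; abstract calculus of `B9Eq39Adjoint`: sites `S`, shifts `T : ι → Equiv.Perm S`, background `U : ι → S → 𝔸ˣ`).
* §1 (any ring) `R_sub_R_eq` (`R(A)X − R(B)X = R(B)(R(B⁻¹A)X − X)`), `R_inv_R_eq`, ★ `covDstar_conjDefect` (`D*_ν` of a conjugation-defect field `y ↦ R(P(y))φ(y) − φ(y)`),
  ★ `curl_covD_eq_basepoint` (`D_UD_Uφ(p_{μν}(x)) = [R(U(∂p))φ(x) − φ(x)] + [R(U(∂p))E − E]`, `E = R(U_ν(x))(D_μφ)(x+e_ν) + (D_νφ)(x)`),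
  ★★ `covDstar_curl_covD_eq` (the displayed decomposition of `D*_ν(D_UD_Uφ)(p_{νμ})(x)` with `ℛ_ν` written out), `R_sub_R_sub_comm_eq` + `inv_sub_inv_add_sub_eq` (the exact
  second-order remainder of `R(A)X − R(B)X − [(A − B), X]`).
* §2 (normed ring; `‖U‖ ≤ 1`, `‖U⁻¹‖ ≤ 1`; plaquettes within `a` of `1`, `0 ≤ a`) `normLeOne_plaqU`∕`normLeOne_conj` (bi-contractivity of the plaquette and of its
  transport), `norm_conj_sub_one_le`, `norm_covDstar_le_norm_covD`, `norm_covDstar_le`, ★★ `norm_covDstar_curl_covD_sub_le` (the bound on `ℛ_ν`),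
  ★ `norm_R_sub_R_sub_comm_le` (`≤ 8a²‖X‖`), ★★ `norm_sum_R_sub_R_le` (`‖Σ_ν[R(A_ν)X − R(B_ν)X]‖ ≤ 2‖Σ_ν(A_ν − B_ν)‖‖X‖ + 8|ι|a²‖X‖`),
  ★★★ `norm_divP_curl_covD_le` (the co-curl of the curvature commutator: `‖D*D_U(D_Uφ)_μ(x)‖ ≤ (2‖Σ_ν(P̆_ν − P_ν)‖ + 8|ι|a²)·‖φ(x)‖ + 2a·Σ_ν(five covariant differences)`).
HONEST SCOPE.  Exact lattice algebra and its triangle-inequality bounds ([folklore] in [Balaban1985BackgroundPropagators] (3.1)–(3.9) letters); no pairing, no sum over the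
torus, no dictionary to `T3PrintedRegularMinimiser.DivSmall` (the oriented (1.2) sum `Σ_{ν<μ} − Σ_{ν>μ}` of `plaqFT` letters vs the all-`ν` sum of `plaqU ν μ` letters here agree to
first order only; not typed); nothing of S3, P-cov3, E′ or the crux.

References: T. Bałaban, CMP 99 (1985) 389–434 [Balaban1985BackgroundPropagators] ((3.1)–(3.5) pp.390–391, (3.8)–(3.9) p.392); CMP 99 (1985) 75–102 [Balaban1985RegularSpaces]
((1.1)–(1.2) p.76, (1.9) p.77); CMP 102 (1985) 277–309 [Balaban1985Variational] ((2) p.278, (135) p.298, Prop. 7 p.299).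
-/

noncomputable section

namespace Summit.QuantumFields.YangMills.Theorems.Prop7CoCurlOfCurvatureCommutator

open Literature.MathematicalPhysics.QuantumFieldTheory.Balaban1983to89
open B9Eq39Adjoint (R R_def R_add R_sub covD covDstar curl plaqU divP divP_curl)
open B11Eq135Weitzenbock (norm_R_sub_self_le)
open B9Eq310Hermitian (norm_R_le)
open Summit.QuantumFields.YangMills.Theorems.Prop7CovariantCurlOfGrad (curl_covD_eq_conj_plaqU norm_covD_le)

/-! ## §1 Ring-level identities -/

section RingLevel

variable {𝔸 : Type*} [Ring 𝔸] {S : Type*} {ι : Type*} (T : ι → Equiv.Perm S) (U : ι → S → 𝔸ˣ)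

/-- `R(A)X − R(B)X = R(B)(R(B⁻¹A)X − X)` — the difference of two conjugations is a conjugated conjugation defect. [folklore] -/
theorem R_sub_R_eq (A B : 𝔸ˣ) (X : 𝔸) : R A X - R B X = R B (R (B⁻¹ * A) X - X) := by
  rw [R_sub, ← B9Eq39Adjoint.R_mul, mul_inv_cancel_left]

/-- `R(W⁻¹)(R(P)X) = R(W⁻¹PW)(R(W⁻¹)X)` — a conjugation transported along a bond is the conjugation by the transported unit. [folklore] -/
theorem R_inv_R_eq (W P : 𝔸ˣ) (X : 𝔸) : R W⁻¹ (R P X) = R (W⁻¹ * P * W) (R W⁻¹ X) := by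
  rw [← B9Eq39Adjoint.R_mul, ← B9Eq39Adjoint.R_mul, mul_assoc (W⁻¹ * P), mul_inv_cancel, mul_one]

/-- ★ **`D*_ν` OF A CONJUGATION-DEFECT FIELD**: for units `P(y)` and a site function `φ`,
`D*_ν(y ↦ R(P(y))φ(y) − φ(y))(x) = [R(P̆)φ(x) − R(P(x))φ(x)] + [R(P̆)(D*_νφ)(x) − (D*_νφ)(x)]`, `P̆ = U_ν(x′)⁻¹P(x′)U_ν(x′)`, `x′ = x − e_ν` — the value `φ(x)` enters
only through the DIFFERENCE of the two conjugations. [cite: Balaban1985BackgroundPropagators, (3.8) p.392, (3.5) p.391] -/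
theorem covDstar_conjDefect (P : S → 𝔸ˣ) (φ : S → 𝔸) (ν : ι) (x : S) :
    covDstar T U ν (fun y => R (P y) (φ y) - φ y) x
      = (R ((U ν ((T ν).symm x))⁻¹ * P ((T ν).symm x) * U ν ((T ν).symm x)) (φ x) - R (P x) (φ x))
        + (R ((U ν ((T ν).symm x))⁻¹ * P ((T ν).symm x) * U ν ((T ν).symm x)) (covDstar T U ν φ x) - covDstar T U ν φ x) := by
  simp only [covDstar, R_sub, R_inv_R_eq (U ν ((T ν).symm x)) (P ((T ν).symm x))]
  abel

/-- ★ **THE CURVATURE COMMUTATOR AT THE BASE POINT**: on commuting shifts,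
`(D_UD_Uφ)(p_{μν}(x)) = [R(U(∂p))φ(x) − φ(x)] + [R(U(∂p))E − E]` with `E = R(U_ν(x))(D_μφ)(x+e_ν) + (D_νφ)(x)` (the transported far-corner value of
✓`curl_covD_eq_conj_plaqU` is `φ(x) + E`). [cite: Balaban1985BackgroundPropagators, (3.1) p.390, (3.3)-(3.4) pp.390-391] -/
theorem curl_covD_eq_basepoint (φ : S → 𝔸) (μ ν : ι) (x : S) (hT : T ν (T μ x) = T μ (T ν x)) :
    curl T U (fun κ => covD T U κ φ) μ ν x
      = (R (plaqU T U μ ν x) (φ x) - φ x)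
        + (R (plaqU T U μ ν x) (R (U ν x) (covD T U μ φ (T ν x)) + covD T U ν φ x)
            - (R (U ν x) (covD T U μ φ (T ν x)) + covD T U ν φ x)) := by
  rw [curl_covD_eq_conj_plaqU T U φ μ ν x hT]
  have h : R (U ν x * U μ (T ν x)) (φ (T μ (T ν x))) = φ x + (R (U ν x) (covD T U μ φ (T ν x)) + covD T U ν φ x) := by
    simp only [covD, R_sub, B9Eq39Adjoint.R_mul]
    abel
  rw [h, R_add]
  abel

set_option maxHeartbeats 400000 in
/-- ★★ **`D*_ν` OF THE CURVATURE COMMUTATOR, DECOMPOSED**: on commuting shifts, with `P(y) = U(∂p_{νμ}(y))`, `E(y) = R(U_μ(y))(D_νφ)(y+e_μ) + (D_μφ)(y)`,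
`x′ = x − e_ν`, `P̆ = U_ν(x′)⁻¹P(x′)U_ν(x′)`:
`D*_ν((D_UD_Uφ)(p_{νμ}))(x) = [R(P̆)φ(x) − R(P(x))φ(x)] + {[R(P̆)(D*_νφ)(x) − (D*_νφ)(x)] + [R(P̆)E(x) − R(P(x))E(x)] + [R(P̆)(D*_νE)(x) − (D*_νE)(x)]}`.
[cite: Balaban1985BackgroundPropagators, (3.4) p.391, (3.8)-(3.9) p.392] -/
theorem covDstar_curl_covD_eq (hT : ∀ (μ ν : ι) (y : S), T μ (T ν y) = T ν (T μ y)) (φ : S → 𝔸) (μ ν : ι) (x : S) :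
    covDstar T U ν (curl T U (fun κ => covD T U κ φ) ν μ) x
      = (R ((U ν ((T ν).symm x))⁻¹ * plaqU T U ν μ ((T ν).symm x) * U ν ((T ν).symm x)) (φ x) - R (plaqU T U ν μ x) (φ x))
        + ((R ((U ν ((T ν).symm x))⁻¹ * plaqU T U ν μ ((T ν).symm x) * U ν ((T ν).symm x)) (covDstar T U ν φ x) - covDstar T U ν φ x)
          + (R ((U ν ((T ν).symm x))⁻¹ * plaqU T U ν μ ((T ν).symm x) * U ν ((T ν).symm x))
                (R (U μ x) (covD T U ν φ (T μ x)) + covD T U μ φ x)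
              - R (plaqU T U ν μ x) (R (U μ x) (covD T U ν φ (T μ x)) + covD T U μ φ x))
          + (R ((U ν ((T ν).symm x))⁻¹ * plaqU T U ν μ ((T ν).symm x) * U ν ((T ν).symm x))
                (covDstar T U ν (fun y => R (U μ y) (covD T U ν φ (T μ y)) + covD T U μ φ y) x)
              - covDstar T U ν (fun y => R (U μ y) (covD T U ν φ (T μ y)) + covD T U μ φ y) x)) := by
  have hcurl : curl T U (fun κ => covD T U κ φ) ν μ
      = (fun y => R (plaqU T U ν μ y) (φ y) - φ y)
        + (fun y => R (plaqU T U ν μ y) (R (U μ y) (covD T U ν φ (T μ y)) + covD T U μ φ y)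
            - (R (U μ y) (covD T U ν φ (T μ y)) + covD T U μ φ y)) := by
    funext y
    exact curl_covD_eq_basepoint T U φ ν μ y (hT μ ν y)
  rw [hcurl, B9Eq39Adjoint.covDstar_add, covDstar_conjDefect, covDstar_conjDefect]
  abel

set_option maxHeartbeats 400000 in
/-- **THE SECOND-ORDER REMAINDER OF A CONJUGATION DIFFERENCE, EXACTLY**: for units `A, B`,
`R(A)X − R(B)X = [(A − B)X − X(A − B)] + {(A − B)X(A⁻¹ − 1) + X((A⁻¹ − B⁻¹) + (A − B)) + (B − 1)X(A⁻¹ − B⁻¹)}` — the commutator with `A − B` plus products of two small factors.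
[folklore] -/
theorem R_sub_R_sub_comm_eq (A B : 𝔸ˣ) (X : 𝔸) :
    R A X - R B X
      = ((A : 𝔸) - B) * X - X * ((A : 𝔸) - B)
        + (((A : 𝔸) - B) * X * (((A⁻¹ : 𝔸ˣ) : 𝔸) - 1) + X * ((((A⁻¹ : 𝔸ˣ) : 𝔸) - ((B⁻¹ : 𝔸ˣ) : 𝔸)) + ((A : 𝔸) - B))
            + ((B : 𝔸) - 1) * X * (((A⁻¹ : 𝔸ˣ) : 𝔸) - ((B⁻¹ : 𝔸ˣ) : 𝔸))) := by
  simp only [R_def]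
  noncomm_ring

/-- `(A⁻¹ − B⁻¹) + (A − B) = (1 − A⁻¹)(A − B) + A⁻¹(A − B)(1 − B⁻¹)` for units (`A⁻¹ − B⁻¹ = −A⁻¹(A − B)B⁻¹`) — second order. [folklore] -/
theorem inv_sub_inv_add_sub_eq (A B : 𝔸ˣ) :
    (((A⁻¹ : 𝔸ˣ) : 𝔸) - ((B⁻¹ : 𝔸ˣ) : 𝔸)) + ((A : 𝔸) - B)
      = (1 - ((A⁻¹ : 𝔸ˣ) : 𝔸)) * ((A : 𝔸) - B) + ((A⁻¹ : 𝔸ˣ) : 𝔸) * ((A : 𝔸) - B) * (1 - ((B⁻¹ : 𝔸ˣ) : 𝔸)) := by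
  have hA : ((A⁻¹ : 𝔸ˣ) : 𝔸) * (A : 𝔸) = 1 := Units.inv_mul A
  have hB : (B : 𝔸) * ((B⁻¹ : 𝔸ˣ) : 𝔸) = 1 := Units.mul_inv B
  have e1 : ((A⁻¹ : 𝔸ˣ) : 𝔸) * ((A : 𝔸) - B) * (1 - ((B⁻¹ : 𝔸ˣ) : 𝔸))
      = ((A⁻¹ : 𝔸ˣ) : 𝔸) * ((A : 𝔸) - B) - (((A⁻¹ : 𝔸ˣ) : 𝔸) * (A : 𝔸)) * ((B⁻¹ : 𝔸ˣ) : 𝔸)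
          + ((A⁻¹ : 𝔸ˣ) : 𝔸) * ((B : 𝔸) * ((B⁻¹ : 𝔸ˣ) : 𝔸)) := by noncomm_ring
  rw [e1, hA, hB]
  noncomm_ring

end RingLevel

/-! ## §2 Norm bounds at a unitary-type background with plaquettes within `a` of `1` -/

section NormLevel

variable {𝔸 : Type*} [NormedRing 𝔸] {S : Type*} {ι : Type*} (T : ι → Equiv.Perm S) (U : ι → S → 𝔸ˣ)

/-- The plaquette unit is in the class when the bond units are. [folklore] -/
theorem normLeOne_plaqU (hU : ∀ (κ : ι) (y : S), ‖(U κ y : 𝔸)‖ ≤ 1 ∧ ‖(((U κ y)⁻¹ : 𝔸ˣ) : 𝔸)‖ ≤ 1) (μ ν : ι) (x : S) :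
    ‖(plaqU T U μ ν x : 𝔸)‖ ≤ 1 ∧ ‖(((plaqU T U μ ν x)⁻¹ : 𝔸ˣ) : 𝔸)‖ ≤ 1 := by
  -- bi-contractivity is closed under products and inverses (`B9Thm310CommutatorDataOfPlaquettes.bicontr_mul`∕`_inv` on the def-Y carrier; here two local lines)
  have hmul : ∀ {V W : 𝔸ˣ}, (‖(V : 𝔸)‖ ≤ 1 ∧ ‖((V⁻¹ : 𝔸ˣ) : 𝔸)‖ ≤ 1) → (‖(W : 𝔸)‖ ≤ 1 ∧ ‖((W⁻¹ : 𝔸ˣ) : 𝔸)‖ ≤ 1) →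
      (‖((V * W : 𝔸ˣ) : 𝔸)‖ ≤ 1 ∧ ‖(((V * W)⁻¹ : 𝔸ˣ) : 𝔸)‖ ≤ 1) := fun hV hW =>
    ⟨by rw [Units.val_mul]; exact (norm_mul_le _ _).trans (mul_le_one₀ hV.1 (norm_nonneg _) hW.1),
     by rw [mul_inv_rev, Units.val_mul]; exact (norm_mul_le _ _).trans (mul_le_one₀ hW.2 (norm_nonneg _) hV.2)⟩
  have hinv : ∀ {V : 𝔸ˣ}, (‖(V : 𝔸)‖ ≤ 1 ∧ ‖((V⁻¹ : 𝔸ˣ) : 𝔸)‖ ≤ 1) → (‖((V⁻¹ : 𝔸ˣ) : 𝔸)‖ ≤ 1 ∧ ‖(((V⁻¹)⁻¹ : 𝔸ˣ) : 𝔸)‖ ≤ 1) :=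
    fun hV => by rw [inv_inv]; exact ⟨hV.2, hV.1⟩
  unfold plaqU
  exact hmul (hmul (hmul (hU μ x) (hU ν (T μ x))) (hinv (hU μ (T ν x)))) (hinv (hU ν x))

/-- `W⁻¹PW` is bi-contractive when `W` and `P` are (the transported plaquette). [folklore] -/
theorem normLeOne_conj {W P : 𝔸ˣ} (hW : ‖(W : 𝔸)‖ ≤ 1 ∧ ‖((W⁻¹ : 𝔸ˣ) : 𝔸)‖ ≤ 1) (hP : ‖(P : 𝔸)‖ ≤ 1 ∧ ‖((P⁻¹ : 𝔸ˣ) : 𝔸)‖ ≤ 1) :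
    ‖((W⁻¹ * P * W : 𝔸ˣ) : 𝔸)‖ ≤ 1 ∧ ‖(((W⁻¹ * P * W)⁻¹ : 𝔸ˣ) : 𝔸)‖ ≤ 1 := by
  constructor
  · rw [Units.val_mul, Units.val_mul]
    exact (norm_mul_le _ _).trans (mul_le_one₀ ((norm_mul_le _ _).trans (mul_le_one₀ hW.2 (norm_nonneg _) hP.1)) (norm_nonneg _) hW.1)
  · rw [mul_inv_rev, mul_inv_rev, inv_inv, Units.val_mul, Units.val_mul]
    exact (norm_mul_le _ _).trans (mul_le_one₀ hW.2 (norm_nonneg _) ((norm_mul_le _ _).trans (mul_le_one₀ hP.2 (norm_nonneg _) hW.1)))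

/-- `‖W⁻¹PW − 1‖ ≤ ‖P − 1‖` — transporting a plaquette along a bond does not increase its distance to `1`. [folklore] -/
theorem norm_conj_sub_one_le {W P : 𝔸ˣ} (hW : ‖(W : 𝔸)‖ ≤ 1 ∧ ‖((W⁻¹ : 𝔸ˣ) : 𝔸)‖ ≤ 1) :
    ‖((W⁻¹ * P * W : 𝔸ˣ) : 𝔸) - 1‖ ≤ ‖(P : 𝔸) - 1‖ := by
  have e : ((W⁻¹ * P * W : 𝔸ˣ) : 𝔸) - 1 = ((W⁻¹ : 𝔸ˣ) : 𝔸) * ((P : 𝔸) - 1) * (W : 𝔸) := by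
    rw [Units.val_mul, Units.val_mul, mul_sub, sub_mul, mul_one, Units.inv_mul]
  rw [e]
  calc ‖((W⁻¹ : 𝔸ˣ) : 𝔸) * ((P : 𝔸) - 1) * (W : 𝔸)‖ ≤ ‖((W⁻¹ : 𝔸ˣ) : 𝔸)‖ * ‖(P : 𝔸) - 1‖ * ‖(W : 𝔸)‖ :=
        (norm_mul_le _ _).trans (mul_le_mul_of_nonneg_right (norm_mul_le _ _) (norm_nonneg _))
    _ ≤ 1 * ‖(P : 𝔸) - 1‖ * 1 := by gcongr <;> [exact hW.2; exact hW.1]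
    _ = ‖(P : 𝔸) - 1‖ := by ring

/-- `‖(D*_νφ)(x)‖ ≤ ‖(D_νφ)(x − e_ν)‖` — the backward difference is the transported forward difference (`D*_νφ(x) = −R(U_ν(x′))⁻¹(D_νφ)(x′)`). [folklore] -/
theorem norm_covDstar_le_norm_covD (hU : ∀ (κ : ι) (y : S), ‖(U κ y : 𝔸)‖ ≤ 1 ∧ ‖(((U κ y)⁻¹ : 𝔸ˣ) : 𝔸)‖ ≤ 1) (φ : S → 𝔸) (ν : ι) (x : S) :
    ‖covDstar T U ν φ x‖ ≤ ‖covD T U ν φ ((T ν).symm x)‖ := by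
  have e : covDstar T U ν φ x = -(R (U ν ((T ν).symm x))⁻¹ (covD T U ν φ ((T ν).symm x))) := by
    simp only [covDstar, covD, R_sub, B9Eq39Adjoint.R_inv_R, Equiv.apply_symm_apply]
    abel
  rw [e, norm_neg]
  have h := hU ν ((T ν).symm x)
  exact norm_R_le h.2 (by rw [inv_inv]; exact h.1) _

/-- `‖(D*_νG)(x)‖ ≤ ‖G(x − e_ν)‖ + ‖G(x)‖`. [folklore] -/
theorem norm_covDstar_le (hU : ∀ (κ : ι) (y : S), ‖(U κ y : 𝔸)‖ ≤ 1 ∧ ‖(((U κ y)⁻¹ : 𝔸ˣ) : 𝔸)‖ ≤ 1) (G : S → 𝔸) (ν : ι) (x : S) :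
    ‖covDstar T U ν G x‖ ≤ ‖G ((T ν).symm x)‖ + ‖G x‖ := by
  unfold covDstar
  have h := hU ν ((T ν).symm x)
  exact (norm_sub_le _ _).trans (add_le_add (norm_R_le h.2 (by rw [inv_inv]; exact h.1) _) le_rfl)

set_option maxHeartbeats 400000 in
/-- ★★ **THE REMAINDER `ℛ_ν` IS FIRST ORDER IN `D_Uφ` AND IN THE CURVATURE**: at a background with `‖U(∂p) − 1‖ ≤ a` for all plaquettes (`0 ≤ a`) and bond units of norm
`≤ 1` with inverses of norm `≤ 1`, on commuting shifts,
`‖D*_ν((D_UD_Uφ)(p_{νμ}))(x) − [R(P̆)φ(x) − R(P(x))φ(x)]‖ ≤ 2a·(‖D_νφ(x′)‖ + 3‖D_νφ(x+e_μ)‖ + 3‖D_μφ(x)‖ + ‖D_νφ(x′+e_μ)‖ + ‖D_μφ(x′)‖)`, `x′ = x − e_ν`.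
[cite: Balaban1985BackgroundPropagators, (3.4) p.391, (3.8)-(3.9) p.392; Balaban1985Variational, (2) p.278] -/
theorem norm_covDstar_curl_covD_sub_le (hT : ∀ (μ ν : ι) (y : S), T μ (T ν y) = T ν (T μ y))
    (hU : ∀ (κ : ι) (y : S), ‖(U κ y : 𝔸)‖ ≤ 1 ∧ ‖(((U κ y)⁻¹ : 𝔸ˣ) : 𝔸)‖ ≤ 1)
    {a : ℝ} (ha : 0 ≤ a) (hplaq : ∀ (μ ν : ι) (y : S), ‖(plaqU T U μ ν y : 𝔸) - 1‖ ≤ a)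
    (φ : S → 𝔸) (μ ν : ι) (x : S) :
    ‖covDstar T U ν (curl T U (fun κ => covD T U κ φ) ν μ) x
        - (R ((U ν ((T ν).symm x))⁻¹ * plaqU T U ν μ ((T ν).symm x) * U ν ((T ν).symm x)) (φ x) - R (plaqU T U ν μ x) (φ x))‖
      ≤ 2 * a * (‖covD T U ν φ ((T ν).symm x)‖ + 3 * ‖covD T U ν φ (T μ x)‖ + 3 * ‖covD T U μ φ x‖
          + ‖covD T U ν φ (T μ ((T ν).symm x))‖ + ‖covD T U μ φ ((T ν).symm x)‖) := by
  set x' : S := (T ν).symm x with hx'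
  set W : 𝔸ˣ := U ν x' with hW
  set Pb : 𝔸ˣ := W⁻¹ * plaqU T U ν μ x' * W with hPb
  set E : S → 𝔸 := fun y => R (U μ y) (covD T U ν φ (T μ y)) + covD T U μ φ y with hE
  rw [covDstar_curl_covD_eq T U hT φ μ ν x]
  simp only [← hx', ← hW, ← hPb]
  rw [add_sub_cancel_left]
  have hWc : ‖(W : 𝔸)‖ ≤ 1 ∧ ‖((W⁻¹ : 𝔸ˣ) : 𝔸)‖ ≤ 1 := hU ν x'
  have hP : ‖(plaqU T U ν μ x : 𝔸)‖ ≤ 1 ∧ ‖(((plaqU T U ν μ x)⁻¹ : 𝔸ˣ) : 𝔸)‖ ≤ 1 := normLeOne_plaqU T U hU ν μ x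
  have hP' : ‖(plaqU T U ν μ x' : 𝔸)‖ ≤ 1 ∧ ‖(((plaqU T U ν μ x')⁻¹ : 𝔸ˣ) : 𝔸)‖ ≤ 1 := normLeOne_plaqU T U hU ν μ x'
  have hPbc : ‖(Pb : 𝔸)‖ ≤ 1 ∧ ‖((Pb⁻¹ : 𝔸ˣ) : 𝔸)‖ ≤ 1 := by rw [hPb]; exact normLeOne_conj hWc hP'
  have hPb1 : ‖(Pb : 𝔸) - 1‖ ≤ a := (norm_conj_sub_one_le hWc).trans (hplaq ν μ x')
  have hPbP : ‖(Pb : 𝔸) - plaqU T U ν μ x‖ ≤ 2 * a := by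
    have e : (Pb : 𝔸) - plaqU T U ν μ x = ((Pb : 𝔸) - 1) - ((plaqU T U ν μ x : 𝔸) - 1) := by abel
    rw [e]
    exact (norm_sub_le _ _).trans (by linarith [hPb1, hplaq ν μ x])
  have hE_le : ∀ y : S, ‖E y‖ ≤ ‖covD T U ν φ (T μ y)‖ + ‖covD T U μ φ y‖ := by
    intro y
    simp only [hE]
    exact (norm_add_le _ _).trans (add_le_add (norm_R_le (hU μ y).1 (hU μ y).2 _) le_rfl)
  have h1 : ‖R Pb (covDstar T U ν φ x) - covDstar T U ν φ x‖ ≤ 2 * a * ‖covD T U ν φ x'‖ := by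
    have hD : ‖covDstar T U ν φ x‖ ≤ ‖covD T U ν φ x'‖ := by
      have := norm_covDstar_le_norm_covD T U hU φ ν x
      rwa [← hx'] at this
    calc ‖R Pb (covDstar T U ν φ x) - covDstar T U ν φ x‖ ≤ 2 * ‖(Pb : 𝔸) - 1‖ * ‖covDstar T U ν φ x‖ := norm_R_sub_self_le hPbc.2 _
      _ ≤ 2 * a * ‖covD T U ν φ x'‖ := by gcongr
  -- `‖R(A)X − R(B)X‖ ≤ 2‖A − B‖‖X‖` for bi-contractive `A, B` (`B9Ineq373HessianPieceBoundsY.norm_R_sub_R_le` on the def-Y carrier; two lines here):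
  have hRR : ∀ {A B : 𝔸ˣ}, (‖(A : 𝔸)‖ ≤ 1 ∧ ‖((A⁻¹ : 𝔸ˣ) : 𝔸)‖ ≤ 1) → (‖(B : 𝔸)‖ ≤ 1 ∧ ‖((B⁻¹ : 𝔸ˣ) : 𝔸)‖ ≤ 1) → ∀ X : 𝔸,
      ‖R A X - R B X‖ ≤ 2 * ‖(A : 𝔸) - B‖ * ‖X‖ := by
    intro A B hA hB X
    rw [R_sub_R_eq]
    have hBA : ‖(((B⁻¹ * A)⁻¹ : 𝔸ˣ) : 𝔸)‖ ≤ 1 := by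
      rw [mul_inv_rev, inv_inv, Units.val_mul]; exact (norm_mul_le _ _).trans (mul_le_one₀ hA.2 (norm_nonneg _) hB.1)
    have h3 : ‖((B⁻¹ * A : 𝔸ˣ) : 𝔸) - 1‖ ≤ ‖(A : 𝔸) - B‖ := by
      have e : ((B⁻¹ * A : 𝔸ˣ) : 𝔸) - 1 = ((B⁻¹ : 𝔸ˣ) : 𝔸) * ((A : 𝔸) - B) := by rw [Units.val_mul, mul_sub, Units.inv_mul]
      rw [e]
      exact (norm_mul_le _ _).trans (by nlinarith [hB.2, norm_nonneg ((A : 𝔸) - B), norm_nonneg ((B⁻¹ : 𝔸ˣ) : 𝔸)])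
    calc ‖R B (R (B⁻¹ * A) X - X)‖ ≤ ‖R (B⁻¹ * A) X - X‖ := norm_R_le hB.1 hB.2 _
      _ ≤ 2 * ‖((B⁻¹ * A : 𝔸ˣ) : 𝔸) - 1‖ * ‖X‖ := norm_R_sub_self_le hBA X
      _ ≤ 2 * ‖(A : 𝔸) - B‖ * ‖X‖ := by gcongr
  have h2 : ‖R Pb (E x) - R (plaqU T U ν μ x) (E x)‖ ≤ 2 * (2 * a) * (‖covD T U ν φ (T μ x)‖ + ‖covD T U μ φ x‖) := by
    calc ‖R Pb (E x) - R (plaqU T U ν μ x) (E x)‖ ≤ 2 * ‖(Pb : 𝔸) - plaqU T U ν μ x‖ * ‖E x‖ := hRR hPbc hP (E x)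
      _ ≤ 2 * (2 * a) * (‖covD T U ν φ (T μ x)‖ + ‖covD T U μ φ x‖) := by gcongr; exact hE_le x
  have h3 : ‖R Pb (covDstar T U ν E x) - covDstar T U ν E x‖
      ≤ 2 * a * ((‖covD T U ν φ (T μ x')‖ + ‖covD T U μ φ x'‖) + (‖covD T U ν φ (T μ x)‖ + ‖covD T U μ φ x‖)) := by
    have hD : ‖covDstar T U ν E x‖ ≤ (‖covD T U ν φ (T μ x')‖ + ‖covD T U μ φ x'‖) + (‖covD T U ν φ (T μ x)‖ + ‖covD T U μ φ x‖) := by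
      have := norm_covDstar_le T U hU E ν x
      rw [← hx'] at this
      exact this.trans (add_le_add (hE_le x') (hE_le x))
    calc ‖R Pb (covDstar T U ν E x) - covDstar T U ν E x‖ ≤ 2 * ‖(Pb : 𝔸) - 1‖ * ‖covDstar T U ν E x‖ := norm_R_sub_self_le hPbc.2 _
      _ ≤ 2 * a * ((‖covD T U ν φ (T μ x')‖ + ‖covD T U μ φ x'‖) + (‖covD T U ν φ (T μ x)‖ + ‖covD T U μ φ x‖)) := by gcongr
  have hEx : (fun y => R (U μ y) (covD T U ν φ (T μ y)) + covD T U μ φ y) = E := rfl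
  have hEx' : R (U μ x) (covD T U ν φ (T μ x)) + covD T U μ φ x = E x := rfl
  rw [hEx, hEx']
  have hsum : ‖(R Pb (covDstar T U ν φ x) - covDstar T U ν φ x) + (R Pb (E x) - R (plaqU T U ν μ x) (E x))
        + (R Pb (covDstar T U ν E x) - covDstar T U ν E x)‖
      ≤ ‖R Pb (covDstar T U ν φ x) - covDstar T U ν φ x‖ + ‖R Pb (E x) - R (plaqU T U ν μ x) (E x)‖
        + ‖R Pb (covDstar T U ν E x) - covDstar T U ν E x‖ := norm_add₃_le
  refine hsum.trans ?_
  nlinarith [h1, h2, h3, norm_nonneg (covD T U ν φ x'), norm_nonneg (covD T U μ φ x), norm_nonneg (covD T U ν φ (T μ x')),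
    norm_nonneg (covD T U μ φ x'), norm_nonneg (covD T U ν φ (T μ x))]

set_option maxHeartbeats 400000 in
/-- ★ **THE SECOND-ORDER REMAINDER OF A CONJUGATION DIFFERENCE IS `≤ 8a²‖X‖`**: for units `A, B` within `a` of `1` (norm `≤ 1`, inverses of norm `≤ 1`),
`‖R(A)X − R(B)X − [(A − B)X − X(A − B)]‖ ≤ 8a²·‖X‖` (`R_sub_R_sub_comm_eq`: three products of two small factors, `‖A − B‖ ≤ 2a`). [folklore] -/
theorem norm_R_sub_R_sub_comm_le {A B : 𝔸ˣ} (hA : ‖(A : 𝔸)‖ ≤ 1 ∧ ‖((A⁻¹ : 𝔸ˣ) : 𝔸)‖ ≤ 1) (hB : ‖(B : 𝔸)‖ ≤ 1 ∧ ‖((B⁻¹ : 𝔸ˣ) : 𝔸)‖ ≤ 1)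
    {a : ℝ} (ha : 0 ≤ a) (hA1 : ‖(A : 𝔸) - 1‖ ≤ a) (hB1 : ‖(B : 𝔸) - 1‖ ≤ a) (X : 𝔸) :
    ‖R A X - R B X - (((A : 𝔸) - B) * X - X * ((A : 𝔸) - B))‖ ≤ 8 * a ^ 2 * ‖X‖ := by
  rw [R_sub_R_sub_comm_eq, add_sub_cancel_left]
  have hAB : ‖(A : 𝔸) - B‖ ≤ 2 * a := by
    have e : (A : 𝔸) - B = ((A : 𝔸) - 1) - ((B : 𝔸) - 1) := by abel
    rw [e]; exact (norm_sub_le _ _).trans (by linarith)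
  have hAi : ‖((A⁻¹ : 𝔸ˣ) : 𝔸) - 1‖ ≤ a := by
    have e : ((A⁻¹ : 𝔸ˣ) : 𝔸) - 1 = ((A⁻¹ : 𝔸ˣ) : 𝔸) * (1 - (A : 𝔸)) := by rw [mul_sub, mul_one, Units.inv_mul]
    rw [e]
    calc ‖((A⁻¹ : 𝔸ˣ) : 𝔸) * (1 - (A : 𝔸))‖ ≤ ‖((A⁻¹ : 𝔸ˣ) : 𝔸)‖ * ‖1 - (A : 𝔸)‖ := norm_mul_le _ _
      _ ≤ 1 * a := mul_le_mul hA.2 (by rw [norm_sub_rev]; exact hA1) (norm_nonneg _) zero_le_one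
      _ = a := one_mul a
  have hBi : ‖1 - ((B⁻¹ : 𝔸ˣ) : 𝔸)‖ ≤ a := by
    have e : 1 - ((B⁻¹ : 𝔸ˣ) : 𝔸) = ((B⁻¹ : 𝔸ˣ) : 𝔸) * ((B : 𝔸) - 1) := by rw [mul_sub, mul_one, Units.inv_mul]
    rw [e]
    calc ‖((B⁻¹ : 𝔸ˣ) : 𝔸) * ((B : 𝔸) - 1)‖ ≤ ‖((B⁻¹ : 𝔸ˣ) : 𝔸)‖ * ‖(B : 𝔸) - 1‖ := norm_mul_le _ _
      _ ≤ 1 * a := mul_le_mul hB.2 hB1 (norm_nonneg _) zero_le_one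
      _ = a := one_mul a
  have hinv : ‖(((A⁻¹ : 𝔸ˣ) : 𝔸) - ((B⁻¹ : 𝔸ˣ) : 𝔸))‖ ≤ ‖(A : 𝔸) - B‖ := by
    have e : ((A⁻¹ : 𝔸ˣ) : 𝔸) - ((B⁻¹ : 𝔸ˣ) : 𝔸) = ((A⁻¹ : 𝔸ˣ) : 𝔸) * ((B : 𝔸) - A) * ((B⁻¹ : 𝔸ˣ) : 𝔸) := by
      rw [mul_sub, sub_mul, Units.mul_inv_cancel_right, Units.inv_mul, one_mul]
    rw [e]
    calc ‖((A⁻¹ : 𝔸ˣ) : 𝔸) * ((B : 𝔸) - A) * ((B⁻¹ : 𝔸ˣ) : 𝔸)‖ ≤ ‖((A⁻¹ : 𝔸ˣ) : 𝔸)‖ * ‖(B : 𝔸) - A‖ * ‖((B⁻¹ : 𝔸ˣ) : 𝔸)‖ :=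
          (norm_mul_le _ _).trans (mul_le_mul_of_nonneg_right (norm_mul_le _ _) (norm_nonneg _))
      _ ≤ 1 * ‖(B : 𝔸) - A‖ * 1 :=
          mul_le_mul (mul_le_mul_of_nonneg_right hA.2 (norm_nonneg _)) hB.2 (norm_nonneg _) (by positivity)
      _ = ‖(A : 𝔸) - B‖ := by rw [one_mul, mul_one, norm_sub_rev]
  have hmid : ‖(((A⁻¹ : 𝔸ˣ) : 𝔸) - ((B⁻¹ : 𝔸ˣ) : 𝔸)) + ((A : 𝔸) - B)‖ ≤ 2 * a * ‖(A : 𝔸) - B‖ := by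
    rw [inv_sub_inv_add_sub_eq]
    have n1 : ‖(1 - ((A⁻¹ : 𝔸ˣ) : 𝔸)) * ((A : 𝔸) - B)‖ ≤ a * ‖(A : 𝔸) - B‖ :=
      (norm_mul_le _ _).trans (mul_le_mul_of_nonneg_right (by rw [norm_sub_rev]; exact hAi) (norm_nonneg _))
    have n2 : ‖((A⁻¹ : 𝔸ˣ) : 𝔸) * ((A : 𝔸) - B) * (1 - ((B⁻¹ : 𝔸ˣ) : 𝔸))‖ ≤ 1 * ‖(A : 𝔸) - B‖ * a :=
      (norm_mul_le _ _).trans (mul_le_mul ((norm_mul_le _ _).trans (mul_le_mul_of_nonneg_right hA.2 (norm_nonneg _))) hBi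
        (norm_nonneg _) (by positivity))
    exact (norm_add_le_of_le n1 n2).trans (le_of_eq (by ring))
  have t1 : ‖((A : 𝔸) - B) * X * (((A⁻¹ : 𝔸ˣ) : 𝔸) - 1)‖ ≤ 2 * a * ‖X‖ * a :=
    (norm_mul_le _ _).trans (mul_le_mul ((norm_mul_le _ _).trans (mul_le_mul_of_nonneg_right hAB (norm_nonneg _))) hAi
      (norm_nonneg _) (by positivity))
  have t2 : ‖X * ((((A⁻¹ : 𝔸ˣ) : 𝔸) - ((B⁻¹ : 𝔸ˣ) : 𝔸)) + ((A : 𝔸) - B))‖ ≤ ‖X‖ * (2 * a * (2 * a)) :=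
    (norm_mul_le _ _).trans (mul_le_mul_of_nonneg_left (hmid.trans (by gcongr)) (norm_nonneg _))
  have t3 : ‖((B : 𝔸) - 1) * X * (((A⁻¹ : 𝔸ˣ) : 𝔸) - ((B⁻¹ : 𝔸ˣ) : 𝔸))‖ ≤ a * ‖X‖ * (2 * a) :=
    (norm_mul_le _ _).trans (mul_le_mul ((norm_mul_le _ _).trans (mul_le_mul_of_nonneg_right hB1 (norm_nonneg _)))
      (hinv.trans hAB) (norm_nonneg _) (by positivity))
  calc ‖((A : 𝔸) - B) * X * (((A⁻¹ : 𝔸ˣ) : 𝔸) - 1) + X * ((((A⁻¹ : 𝔸ˣ) : 𝔸) - ((B⁻¹ : 𝔸ˣ) : 𝔸)) + ((A : 𝔸) - B))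
        + ((B : 𝔸) - 1) * X * (((A⁻¹ : 𝔸ˣ) : 𝔸) - ((B⁻¹ : 𝔸ˣ) : 𝔸))‖
      ≤ 2 * a * ‖X‖ * a + ‖X‖ * (2 * a * (2 * a)) + a * ‖X‖ * (2 * a) := norm_add₃_le.trans (by linarith [t1, t2, t3])
    _ = 8 * a ^ 2 * ‖X‖ := by ring

set_option maxHeartbeats 400000 in
/-- ★★ **A SUM OF CONJUGATION DIFFERENCES IS THE COMMUTATOR WITH THE SUMMED DIFFERENCE, UP TO `8|ι|a²`**: for families of units `A_ν, B_ν` within `a` of `1`,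
`‖Σ_ν[R(A_ν)X − R(B_ν)X]‖ ≤ 2·‖Σ_ν(A_ν − B_ν)‖·‖X‖ + 8·|ι|·a²·‖X‖` — the FIRST-order term sees only the (oriented) SUM of the differences (for transported-vs-local plaquettes:
the covariant divergence of the curvature), every other term is second order in the curvature. [cite: Balaban1985RegularSpaces, (1.1)-(1.2) p.76, (1.9) p.77] -/
theorem norm_sum_R_sub_R_le [Fintype ι] (A B : ι → 𝔸ˣ)
    (hA : ∀ ν, ‖(A ν : 𝔸)‖ ≤ 1 ∧ ‖(((A ν)⁻¹ : 𝔸ˣ) : 𝔸)‖ ≤ 1) (hB : ∀ ν, ‖(B ν : 𝔸)‖ ≤ 1 ∧ ‖(((B ν)⁻¹ : 𝔸ˣ) : 𝔸)‖ ≤ 1)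
    {a : ℝ} (ha : 0 ≤ a) (hA1 : ∀ ν, ‖(A ν : 𝔸) - 1‖ ≤ a) (hB1 : ∀ ν, ‖(B ν : 𝔸) - 1‖ ≤ a) (X : 𝔸) :
    ‖∑ ν, (R (A ν) X - R (B ν) X)‖ ≤ 2 * ‖∑ ν, ((A ν : 𝔸) - B ν)‖ * ‖X‖ + 8 * Fintype.card ι * a ^ 2 * ‖X‖ := by
  classical
  set Rem : ι → 𝔸 := fun ν => R (A ν) X - R (B ν) X - (((A ν : 𝔸) - B ν) * X - X * ((A ν : 𝔸) - B ν)) with hRem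
  have hsplit : ∑ ν, (R (A ν) X - R (B ν) X)
      = ((∑ ν, ((A ν : 𝔸) - B ν)) * X - X * ∑ ν, ((A ν : 𝔸) - B ν)) + ∑ ν, Rem ν := by
    rw [Finset.sum_mul, Finset.mul_sum, ← Finset.sum_sub_distrib, ← Finset.sum_add_distrib]
    refine Finset.sum_congr rfl fun ν _ => ?_
    simp only [hRem]
    abel
  rw [hsplit]
  have hcomm : ‖(∑ ν, ((A ν : 𝔸) - B ν)) * X - X * ∑ ν, ((A ν : 𝔸) - B ν)‖ ≤ 2 * ‖∑ ν, ((A ν : 𝔸) - B ν)‖ * ‖X‖ := by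
    refine (norm_sub_le _ _).trans ?_
    have n1 := norm_mul_le (∑ ν, ((A ν : 𝔸) - B ν)) X
    have n2 := norm_mul_le X (∑ ν, ((A ν : 𝔸) - B ν))
    linarith [n1, n2]
  have hrem : ‖∑ ν, Rem ν‖ ≤ 8 * Fintype.card ι * a ^ 2 * ‖X‖ := by
    calc ‖∑ ν, Rem ν‖ ≤ ∑ ν, ‖Rem ν‖ := norm_sum_le _ _
      _ ≤ ∑ _ν : ι, 8 * a ^ 2 * ‖X‖ := Finset.sum_le_sum fun ν _ => norm_R_sub_R_sub_comm_le (hA ν) (hB ν) ha (hA1 ν) (hB1 ν) X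
      _ = 8 * Fintype.card ι * a ^ 2 * ‖X‖ := by rw [Finset.sum_const, Finset.card_univ, nsmul_eq_mul]; ring
  exact (norm_add_le _ _).trans (add_le_add hcomm hrem)

set_option maxHeartbeats 400000 in
/-- ★★★ **THE CO-CURL OF THE CURVATURE COMMUTATOR** (`D*D_U(D_Uφ)_μ(x) = Σ_ν D*_ν((D_UD_Uφ)(p_{νμ}))(x)`, ✓`B9Eq39Adjoint.divP_curl`): at a background with
`‖U(∂p) − 1‖ ≤ a` and bond units of norm `≤ 1` with inverses of norm `≤ 1`, on commuting shifts,
`‖D*D_U(D_Uφ)_μ(x)‖ ≤ (2·‖Σ_ν(P̆_ν − P_ν)‖ + 8|ι|a²)·‖φ(x)‖ + 2a·Σ_ν(‖D_νφ(x−e_ν)‖ + 3‖D_νφ(x+e_μ)‖ + 3‖D_μφ(x)‖ + ‖D_νφ(x−e_ν+e_μ)‖ + ‖D_μφ(x−e_ν)‖)`,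
`P_ν = U(∂p_{νμ}(x))`, `P̆_ν = U_ν(x−e_ν)⁻¹U(∂p_{νμ}(x−e_ν))U_ν(x−e_ν)` — the undifferentiated `φ(x)` is weighted by the (all-orientation) COVARIANT DIVERGENCE OF THE CURVATURE
`Σ_ν(P̆_ν − P_ν)` and by `a²`; everything else carries a covariant difference of `φ` and a factor `a`.
[cite: Balaban1985BackgroundPropagators, (3.4) p.391, (3.8)-(3.9) p.392; Balaban1985RegularSpaces, (1.1)-(1.2) p.76, (1.9) p.77; Balaban1985Variational, (2) p.278, Prop. 7 p.299] -/
theorem norm_divP_curl_covD_le [Fintype ι] [LinearOrder ι] (hT : ∀ (μ ν : ι) (y : S), T μ (T ν y) = T ν (T μ y))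
    (hU : ∀ (κ : ι) (y : S), ‖(U κ y : 𝔸)‖ ≤ 1 ∧ ‖(((U κ y)⁻¹ : 𝔸ˣ) : 𝔸)‖ ≤ 1)
    {a : ℝ} (ha : 0 ≤ a) (hplaq : ∀ (μ ν : ι) (y : S), ‖(plaqU T U μ ν y : 𝔸) - 1‖ ≤ a)
    (φ : S → 𝔸) (μ : ι) (x : S) :
    ‖divP T U (curl T U (fun κ => covD T U κ φ)) μ x‖
      ≤ (2 * ‖∑ ν, ((((U ν ((T ν).symm x))⁻¹ * plaqU T U ν μ ((T ν).symm x) * U ν ((T ν).symm x) : 𝔸ˣ) : 𝔸) - (plaqU T U ν μ x : 𝔸))‖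
            + 8 * Fintype.card ι * a ^ 2) * ‖φ x‖
        + 2 * a * ∑ ν, (‖covD T U ν φ ((T ν).symm x)‖ + 3 * ‖covD T U ν φ (T μ x)‖ + 3 * ‖covD T U μ φ x‖
            + ‖covD T U ν φ (T μ ((T ν).symm x))‖ + ‖covD T U μ φ ((T ν).symm x)‖) := by
  classical
  rw [divP_curl]
  set Pb : ι → 𝔸ˣ := fun ν => (U ν ((T ν).symm x))⁻¹ * plaqU T U ν μ ((T ν).symm x) * U ν ((T ν).symm x) with hPb
  set main : ι → 𝔸 := fun ν => R (Pb ν) (φ x) - R (plaqU T U ν μ x) (φ x) with hmain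
  set rest : ι → 𝔸 := fun ν => covDstar T U ν (curl T U (fun κ => covD T U κ φ) ν μ) x - main ν with hrest
  have hsplit : ∑ ν, covDstar T U ν (curl T U (fun κ => covD T U κ φ) ν μ) x = ∑ ν, main ν + ∑ ν, rest ν := by
    rw [← Finset.sum_add_distrib]
    exact Finset.sum_congr rfl fun ν _ => by simp only [hrest]; abel
  rw [hsplit]
  have hPbc : ∀ ν, ‖(Pb ν : 𝔸)‖ ≤ 1 ∧ ‖(((Pb ν)⁻¹ : 𝔸ˣ) : 𝔸)‖ ≤ 1 := fun ν =>
    normLeOne_conj (hU ν _) (normLeOne_plaqU T U hU ν μ _)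
  have hPb1 : ∀ ν, ‖(Pb ν : 𝔸) - 1‖ ≤ a := fun ν => (norm_conj_sub_one_le (hU ν _)).trans (hplaq ν μ _)
  have hmainle := norm_sum_R_sub_R_le Pb (fun ν => plaqU T U ν μ x) hPbc (fun ν => normLeOne_plaqU T U hU ν μ x) ha hPb1
    (fun ν => hplaq ν μ x) (φ x)
  have hrestle : ‖∑ ν, rest ν‖ ≤ 2 * a * ∑ ν, (‖covD T U ν φ ((T ν).symm x)‖ + 3 * ‖covD T U ν φ (T μ x)‖ + 3 * ‖covD T U μ φ x‖
      + ‖covD T U ν φ (T μ ((T ν).symm x))‖ + ‖covD T U μ φ ((T ν).symm x)‖) := by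
    rw [Finset.mul_sum]
    refine (norm_sum_le _ _).trans (Finset.sum_le_sum fun ν _ => ?_)
    exact norm_covDstar_curl_covD_sub_le T U hT hU ha hplaq φ μ ν x
  calc ‖∑ ν, main ν + ∑ ν, rest ν‖ ≤ ‖∑ ν, main ν‖ + ‖∑ ν, rest ν‖ := norm_add_le _ _
    _ ≤ _ := by
        refine add_le_add ?_ hrestle
        refine hmainle.trans (le_of_eq ?_)
        ring

end NormLevel

end Summit.QuantumFields.YangMills.Theorems.Prop7CoCurlOfCurvatureCommutator

end
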